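import Summits.AtomisticToContinuum.HydrodynamicLimit.Theses.AntiMazurCoboundaries
import HarnessLib

/-!
# The kinetic-class upgrade of line `explosion-limited-jamming` — the typing debt, audited

Crux `Summit.AtomisticToContinuum.HydrodynamicLimit.Theses.AntiMazurCoboundaries.KineticWindowGronwall`
(stmt-AtomisticToContinuum-9282, `= FluxGibbsianityLdDrude.KineticWindowGronwall` by `rfl`; literally
`KineticFluxLdDecay → RelEntropyVanishing`), skeleton line `explosion-limited-jamming`, registered stub
`stub_kineticClassUpgrade : KineticFluxLdDecay → KineticFluxLdDecayQuadLocUnif` — the crux's TYPING DEBT: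
the antecedent `A := KineticFluxLdDecay` (shared crux stmt-AtomisticToContinuum-10967) AS TYPED (bounded class
`|g| ≤ κ`, `κ` chosen AFTER `σ`, window `τ` and threshold `N₀` pointwise in `σ`) versus the form the line's
relative-entropy dock consumes, `A⁺ := KineticFluxLdDecayQuadLocUnif` (quadratic-growth class `|g(w)| ≤ κ(1 + ‖w‖²)`,
`κ` chosen BEFORE `σ`, `τ, N₀` locally uniform in `σ` on compacts `[σ₁, σ₀)`).

What this file records, sorry-free:

* the window of the skeleton and the window of the route decl are the same real number
  (`window_eq_cast`: `τ ((N : ℝ) + 1)^{-1/3} = τ ((N + 1 : ℕ) : ℝ)^{-1/3}`), and the two right-hand sides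
  `exp (δ ((N : ℝ) + 1))`, `exp (δ (↑N + 1))` are the same term — so no junk separates `A` from `A⁺`;
* the upgrade is a GENUINE STRENGTHENING, in two rungs: `A⁺ → A_Q → A` (`quad_of_quadLocUnif`,
  `kineticFluxLdDecay_of_quad`, `kineticFluxLdDecay_of_quadLocUnif`), where `A_Q := KineticFluxLdDecayQuad` is the
  intermediate re-typing of 10967 shared verbatim by all three skeleton lines of this crux (ideator 3's
  `KineticFluxLdDecayQuad` = dlr-block-transfer's `KineticFluxLdDecayQ` = self-similar-block-periodisation's
  `KineticFluxLdDecayQuad`: quadratic class, `κ` before `σ`, but `τ, N₀` still pointwise in `σ`);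
* consequently the registered stub `A → A⁺` is, over this file, exactly the assertion that `A` and `A⁺` are
  EQUIVALENT (`kineticClassUpgrade_iff`), and it dissolves to `fun _ => h` given `h : A⁺`
  (`kineticClassUpgrade_of_retyped`) — the stub is blocked on `A⁺` itself (a re-typing of 10967 that is not a
  board item), not on any weaker statement;
* the registered helper stub `stub_kineticClassConverse : KineticClassConverse` (`:= A⁺ → A`).

Not derivable here (pure logic does not reach them; recorded in the docstrings, no `sorry`): `A → A_Q` (amplitude
before `σ` and bounded → quadratic class: truncation forces the amplitude to `0`, convexity interpolates but never
extrapolates — barrier notes BN1(e)/BN3 of the crux-ideation panel) and `A_Q → A⁺` (a `∀σ ∃(τ, N₀)` statement gives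
pointwise constants only). Neither `TwoClocks.EquilibriumFastWindowLD` (stmt-14440) nor
`TwoClocks.KineticWindowLDUniform` (stmt-14442) implies `A⁺` by logic: both put the amplitude `∃ β₀` AFTER the
observable `F` and after the flow FAMILY `Φ : (N : ℕ) → …`, and `∃ τ, N₀` after `Φ` and pointwise in `σ`, whereas
`A⁺` has `∃ κ` before `g`, `∃ τ, N₀` before `∀ Φ : TFlow σ N`, locally uniform in `σ`.

References: S. Olla, S. R. S. Varadhan, H.-T. Yau, Comm. Math. Phys. 155 (1993), §3; B. Nachtergaele, H.-T. Yau,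
Comm. Math. Phys. 243 (2003), §5 Lemma 5.1 and §7.2 (the `δ⁻¹M` budget of the quadratic class).
-/

noncomputable section

namespace Summit.AtomisticToContinuum.HydrodynamicLimit.Theorems.KineticWindowGronwallKineticClass

open MeasureTheory Set
open scoped ENNReal BigOperators
open Literature.MathematicalPhysics.KineticTheory (T3 V3 hsDiameter localGibbsLaw)
open Literature.Analysis.FluidPDE
open Summit.AtomisticToContinuum.HydrodynamicLimit.Theses.AntiMazurCoboundaries (KineticFluxLdDecay)

/-! ## Vocabulary (verbatim from the line skeleton) -/

/-- The hard-sphere flow of `N+1` spheres at reduced density `σ` on `𝕋³`. -/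
abbrev TFlow (σ : ℝ) (N : ℕ) : Type :=
  HardSphereFlow (Torus.geometry (Fin 3)) (hsDiameter σ N) (N + 1)

/-- The kinetic window `w = τ ℓ`, `ℓ = (N+1)^{-1/3}` (macroscopically vanishing, `τ × O(1)` mean free times). -/
def window (τ : ℝ) (N : ℕ) : ℝ := τ * ((N : ℝ) + 1) ^ (-(1 / 3 : ℝ))

/-- **The two windows are the same real number**: the skeleton's `window τ N = τ ((N : ℝ) + 1)^{-1/3}` and the
route decl's `τ ((N + 1 : ℕ) : ℝ)^{-1/3}` agree (`Nat.cast_succ`). -/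
theorem window_eq_cast (τ : ℝ) (N : ℕ) : window τ N = τ * ((N + 1 : ℕ) : ℝ) ^ (-(1 / 3 : ℝ)) := by
  simp [window]

/-! ## Statements -/

/-- **THE KINETIC HYPOTHESIS IN THE FORM THE LEDGER CAN CONSUME** (`A⁺`; ideator-3 `KineticFluxLdDecayQuad` + triage
S2): `KineticFluxLdDecay` with (i) the amplitude `κ` chosen BEFORE `σ`, (ii) the QUADRATIC-GROWTH class
`|g(w)| ≤ κ(1 + ‖w‖²)` (the truncated heat flux `q χ_A / A` then has an `A`-independent constant, Gronwall rate `∝ A`,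
which Gaussian tails beat — Nachtergaele–Yau's `δ⁻¹M`), (iii) the window `τ` and threshold `N₀` locally uniform in
`σ` on compacts `[σ₁, σ₀)` (the dock consumes the hypothesis at the continuum of reduced densities `σ ρ̂^{1/3}` met by
the blocks of the reference). An OPEN named conjecture of this programme (the requested re-typing of
stmt-AtomisticToContinuum-10967; obligation node); body verbatim from the line skeleton
`Cruxes/KineticWindowGronwall/Lines/explosion-limited-jamming.lean`. -/
@[conjecture] def KineticFluxLdDecayQuadLocUnif : Prop :=
  ∀ (a θ : ℝ) (u₀ : V3), 0 < a → 0 < θ → ∃ σ₀ : ℝ, 0 < σ₀ ∧ ∃ κ : ℝ, 0 < κ ∧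
    (∀ σ : ℝ, 0 < σ → σ < σ₀ → ∀ (N : ℕ) (Φ : TFlow σ N),
      IsProbabilityMeasure (localGibbsLaw σ (fun _ => a) (fun _ => u₀) (fun _ => θ) N Φ)) ∧
    ∀ (φ : T3 → ℝ) (g : V3 → ℝ), Continuous φ → Continuous g → (∀ x, |φ x| ≤ 1) →
      (∀ v, |g v| ≤ κ * (1 + ‖v‖ ^ 2)) →
      (∀ (c₀ c₂ : ℝ) (b : V3),
        ∫ v, g v * (c₀ + inner ℝ b v + c₂ * ‖v‖ ^ 2) ∂(ProbabilityTheory.stdGaussian V3) = 0) →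
      ∀ δ : ℝ, 0 < δ → ∀ σ₁ : ℝ, 0 < σ₁ → σ₁ < σ₀ → ∃ τ : ℝ, 0 < τ ∧ ∃ N₀ : ℕ,
        ∀ σ : ℝ, σ₁ ≤ σ → σ < σ₀ → ∀ N : ℕ, N₀ ≤ N → ∀ Φ : TFlow σ N,
          ∫⁻ z, ENNReal.ofReal (Real.exp ((window τ N)⁻¹ *
              ∫ s in (0 : ℝ)..(window τ N),
                ∑ i, φ (Φ.flow s z i).1 * g ((Real.sqrt θ)⁻¹ • ((Φ.flow s z i).2 - u₀))))
            ∂(localGibbsLaw σ (fun _ => a) (fun _ => u₀) (fun _ => θ) N Φ) ≤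
          ENNReal.ofReal (Real.exp (δ * ((N : ℝ) + 1)))

/-- **THE INTERMEDIATE RUNG `A_Q`** (quadratic-growth class, `κ` before `σ`, but `τ, N₀` still POINTWISE in `σ`):
verbatim ideator 3's `IdeatorThree.KineticFluxLdDecayQuad` (= `KineticFluxLdDecayQ` of line dlr-block-transfer =
`KineticFluxLdDecayQuad` of line self-similar-block-periodisation; the three skeletons' bodies are byte-identical).
Same frame as `KineticFluxLdDecay`; exponential moments finite for each `N` (conserved kinetic energy). An OPEN
named conjecture (re-typing request BN1/BN3 of the crux-ideation panel for stmt-AtomisticToContinuum-10967). -/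
@[conjecture] def KineticFluxLdDecayQuad : Prop :=
  ∀ (a θ : ℝ) (u₀ : V3), 0 < a → 0 < θ → ∃ σ₀ : ℝ, 0 < σ₀ ∧ ∃ κ : ℝ, 0 < κ ∧ ∀ σ : ℝ, 0 < σ → σ < σ₀ →
    (∀ (N : ℕ) (Φ : HardSphereFlow (Torus.geometry (Fin 3)) (hsDiameter σ N) (N + 1)),
      IsProbabilityMeasure (localGibbsLaw σ (fun _ => a) (fun _ => u₀) (fun _ => θ) N Φ)) ∧
    ∀ (φ : T3 → ℝ) (g : V3 → ℝ), Continuous φ → Continuous g → (∀ x, |φ x| ≤ 1) →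
      (∀ v, |g v| ≤ κ * (1 + ‖v‖ ^ 2)) →
      (∀ (c₀ c₂ : ℝ) (b : V3), ∫ v, g v * (c₀ + inner ℝ b v + c₂ * ‖v‖ ^ 2) ∂(ProbabilityTheory.stdGaussian V3) = 0) →
      ∀ δ : ℝ, 0 < δ → ∃ τ : ℝ, 0 < τ ∧ ∃ N₀ : ℕ, ∀ N : ℕ, N₀ ≤ N →
        ∀ Φ : HardSphereFlow (Torus.geometry (Fin 3)) (hsDiameter σ N) (N + 1),
          ∫⁻ z, ENNReal.ofReal (Real.exp ((τ * ((N + 1 : ℕ) : ℝ) ^ (-(1 / 3 : ℝ)))⁻¹ *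
              ∫ s in (0 : ℝ)..(τ * ((N + 1 : ℕ) : ℝ) ^ (-(1 / 3 : ℝ))),
                ∑ i, φ (Φ.flow s z i).1 * g ((Real.sqrt θ)⁻¹ • ((Φ.flow s z i).2 - u₀))))
            ∂(localGibbsLaw σ (fun _ => a) (fun _ => u₀) (fun _ => θ) N Φ) ≤
          ENNReal.ofReal (Real.exp (δ * (N + 1)))

/-- **THE CONVERSE OF THE REGISTERED STUB** (signature of the registered helper stub `stub_kineticClassConverse`):
the consumable form implies the typed antecedent — `A⁺` is a genuine strengthening of `A`. -/
def KineticClassConverse : Prop :=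
  KineticFluxLdDecayQuadLocUnif → KineticFluxLdDecay

/-! ## The ladder `A⁺ → A_Q → A` -/

/-- The bounded class sits inside the quadratic-growth class at the same constant: `κ ≤ κ (1 + ‖v‖²)`. -/
theorem bound_le_quadClass {κ : ℝ} (hκ : 0 ≤ κ) {g : V3 → ℝ} (hg : ∀ v, |g v| ≤ κ) (v : V3) :
    |g v| ≤ κ * (1 + ‖v‖ ^ 2) := by
  refine (hg v).trans ?_
  have h1 : (1 : ℝ) ≤ 1 + ‖v‖ ^ 2 := le_add_of_nonneg_right (sq_nonneg _)
  simpa using mul_le_mul_of_nonneg_left h1 hκ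

/-- **`A⁺ → A_Q`**: local uniformity on `[σ₁, σ₀)` specialises to the point `σ₁ := σ` (and the two windows / right-hand
sides are the same terms, `window_eq_cast`). -/
theorem quad_of_quadLocUnif (h : KineticFluxLdDecayQuadLocUnif) : KineticFluxLdDecayQuad := by
  intro a θ u₀ ha hθ
  obtain ⟨σ₀, hσ₀, κ, hκ, hP, H⟩ := h a θ u₀ ha hθ
  refine ⟨σ₀, hσ₀, κ, hκ, fun σ hσ hσlt => ⟨hP σ hσ hσlt, ?_⟩⟩
  intro φ g hφ hg hφ1 hgκ horth δ hδ
  obtain ⟨τ, hτ, N₀, hN⟩ := H φ g hφ hg hφ1 hgκ horth δ hδ σ hσ hσlt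
  refine ⟨τ, hτ, N₀, fun N hN₀ Φ => ?_⟩
  have key := hN σ le_rfl hσlt N hN₀ Φ
  rw [window_eq_cast] at key
  simpa using key

/-- **`A_Q → A`** (adapted from `typed_of_quad` / `kineticFluxLdDecay_of_Q` of the sibling skeletons): take the same
`σ₀`, hand the `σ`-uniform `κ` out after `σ`, and use `κ ≤ κ(1 + ‖v‖²)`. -/
theorem kineticFluxLdDecay_of_quad (hQ : KineticFluxLdDecayQuad) : KineticFluxLdDecay := by
  intro a θ u₀ ha hθ
  obtain ⟨σ₀, hσ₀, κ, hκ, H⟩ := hQ a θ u₀ ha hθ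
  refine ⟨σ₀, hσ₀, fun σ hσ hσlt => ⟨(H σ hσ hσlt).1, κ, hκ, ?_⟩⟩
  intro φ g hφ hg hφ1 hgκ horth δ hδ
  exact (H σ hσ hσlt).2 φ g hφ hg hφ1 (bound_le_quadClass hκ.le hgκ) horth δ hδ

/-- **`A⁺ → A`**: the consumable form implies the typed antecedent of the crux. -/
theorem kineticFluxLdDecay_of_quadLocUnif (h : KineticFluxLdDecayQuadLocUnif) : KineticFluxLdDecay :=
  kineticFluxLdDecay_of_quad (quad_of_quadLocUnif h)

/-! ## What the registered stub `A → A⁺` amounts to -/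

/-- NORMAL FORM OF THE DEBT: given the proved converse, the registered stub
`KineticFluxLdDecay → KineticFluxLdDecayQuadLocUnif` is exactly the claim that the typed antecedent and its
consumable form are EQUIVALENT; in particular it dissolves to `fun _ => h` the day 10967 is re-typed as `A⁺` and
proved in that form (`h : A⁺`). -/
def KineticClassUpgradeNormalForm : Prop :=
  (KineticFluxLdDecay → KineticFluxLdDecayQuadLocUnif) ↔ (KineticFluxLdDecay ↔ KineticFluxLdDecayQuadLocUnif)

/-- The normal form holds (one direction is the converse `kineticFluxLdDecay_of_quadLocUnif`). -/
theorem kineticClassUpgrade_iff : KineticClassUpgradeNormalForm :=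
  ⟨fun h => ⟨h, kineticFluxLdDecay_of_quadLocUnif⟩, fun h => h.1⟩

/-- THE DEBT SPLITS AT THE INTERMEDIATE RUNG into two independent halves: amplitude/class (`A → A_Q`: `κ` before
`σ`, bounded → quadratic class; BN1(e)/BN3 — not reachable by truncation or convexity) and `σ`-local uniformity of
`(τ, N₀)` (`A_Q → A⁺`; S2 — a `∀σ ∃(τ, N₀)` statement gives pointwise constants only); the two halves compose to
the stub. Neither half is proved here. -/
def KineticClassUpgradeOfHalves : Prop :=
  (KineticFluxLdDecay → KineticFluxLdDecayQuad) → (KineticFluxLdDecayQuad → KineticFluxLdDecayQuadLocUnif) →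
    (KineticFluxLdDecay → KineticFluxLdDecayQuadLocUnif)

/-- The halves compose (pure logic). -/
theorem kineticClassUpgrade_of_halves : KineticClassUpgradeOfHalves :=
  fun h₁ h₂ hA => h₂ (h₁ hA)

/-! ## The registered helper stub -/

/-- **STUB `stub_kineticClassConverse`** (helper stub of line `explosion-limited-jamming`, crux `KineticWindowGronwall`
stmt-AtomisticToContinuum-9282): the converse of the typing-debt stub `stub_kineticClassUpgrade` holds —
`KineticFluxLdDecayQuadLocUnif → KineticFluxLdDecay`. -/
theorem stub_kineticClassConverse : KineticClassConverse :=
  kineticFluxLdDecay_of_quadLocUnif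

end Summit.AtomisticToContinuum.HydrodynamicLimit.Theorems.KineticWindowGronwallKineticClass

end
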